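import Summits.AtomisticToContinuum.Crystallization.Theorems.FreeSplittingCertificatesRadiusLadderPeriodicHcp
import Literature.MathematicalPhysics.StatisticalMechanics.LennardJonesHcpBelowFcc

/-!
# `FiniteRangeSplitting` (stmt-AtomisticToContinuum-12559): the certified reference value of the LP verdict

Companion of `FreeSplittingCertificatesRadiusLadder` (block-2b unit `b2b-freesplit-A`, gen 7).  VALUE = the
rigorous anchor of a "NOT refuted" verdict of the recurrent-pattern LP — NOT summit progress; nothing here closes an
item.

A finite zoo `Z` REFUTES the rung `RungAt δ R` when every rule has a site row `< e_∞` on it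
(`not_rungAt_of_zoo`); it is NOT refuting as soon as ONE rule `Φ` has all its site rows `≥ e_∞` on `Z`.  The LP
runs of the unit deliver an exact rational rule `Φ` together with the exact minimum `L` of its site rows
(ljlp-cert/1, RESULTS-R2 §4; for the decisive union-66 cell at `R = 2`: `L = −0.709138812139…`, job j037421), and
compare `L` with the NON-certified lattice-sum value `e_hcp(a*) = −0.717589…`.  The comparison that makes
"not refuting" a theorem is `L ≥ e_∞`, and the tree certifies the needed upper bound on `e_∞`:

* `eInf_le_hcpOptimalEnergy` — `e_∞ ≤ e(hcp(a₀, a₀√(2/3))) = −(L₆ʰᶜᵖ)²/(24 L₁₂ʰᶜᵖ)` (the periodic upper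
  bound `periodicUpperBound_proof` at the optimally dilated ideal hcp,
  `lennardJones_hcp_energyPerParticle_attained`);
* `eInf_le_ref` — hence `e_∞ ≤ −0.7175`, from the certified enclosures `14.4542 ≤ L₆ʰᶜᵖ ≤ 14.4593`,
  `12.1322937 ≤ L₁₂ʰᶜᵖ ≤ 12.1322946` (`HcpFccLatticeSumsCertificate`, kernel-evaluated box sums + tail
  bounds; the enclosures give `e* ≤ −0.71752`, we keep the round `−0.7175`, `8.4·10⁻³` below the LP value `L`);
* `not_refuting_of_certificate` — a zoo on which some rule has all site rows `≥ −0.7175` (a FINITE check in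
  exact rational arithmetic: `V_LJ` is a rational function of `r²`, the zoo coordinates are frame-rational, the
  rule takes finitely many rational values on the realised keys) is not in the hypothesis shape of
  `not_rungAt_of_zoo` at that radius — so the JSON-level primal certificate of j037421
  (`L = −0.70913… ≥ −0.7175`) is, with this lemma, a rigorous "the union-66 zoo does not refute the R = 2
  rung", independent of the floating value of `e_hcp(a*)`;
* `not_refuting_of_hcp_fragments` — the by-name corollary of `halfRule_feasibleOn_hcp_ideal`: a zoo of
  injective fragments of ideal hcp stackings `hcpStacking a (a√(2/3))` with `a⁶ ≥ 1/2` (any mixture of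
  spacings, radii, shapes) is never refuting, at any radius, before any LP is run.
-/

noncomputable section
namespace Summit.AtomisticToContinuum.Crystallization.Theorems.StrictSplittingRuleBirth

open scoped BigOperators Classical
open Literature.MathematicalPhysics.StatisticalMechanics
open Literature.MathematicalPhysics.StatisticalMechanics.StackingSums

/-! ## The certified upper bound on `e_∞` -/

/-- **`e_∞ ≤ e*_hcp`**: the energy per particle in the thermodynamic limit is at most the optimal ideal-hcp
energy `−(L₆ʰᶜᵖ)²/(24 L₁₂ʰᶜᵖ)` (periodic upper bound at the optimally dilated ideal hcp). -/
theorem eInf_le_hcpOptimalEnergy :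
    eInf ≤ -(hcpInvPowSum 3 (Real.sqrt (2 / 3)) ^ 2 / (24 * hcpInvPowSum 6 (Real.sqrt (2 / 3)))) := by
  obtain ⟨a, ha, -, he⟩ := lennardJones_hcp_energyPerParticle_attained
  rw [← he]
  exact periodicUpperBound_proof _

/-- **`e_∞ ≤ −0.7175`** (certified: lattice-sum enclosures of `HcpFccLatticeSumsCertificate`). -/
theorem eInf_le_ref : eInf ≤ -(7175 / 10000) := by
  refine eInf_le_hcpOptimalEnergy.trans ?_
  obtain ⟨h3l, -⟩ := hcpInvPowSum_three_bounds
  obtain ⟨h6l, h6u⟩ := hcpInvPowSum_six_bounds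
  have h6 : (0 : ℝ) < hcpInvPowSum 6 (Real.sqrt (2 / 3)) := by linarith
  rw [neg_le_neg_iff, le_div_iff₀ (by positivity)]
  nlinarith [mul_le_mul h3l h3l (by norm_num) (by linarith)]

/-! ## Exact primal certificates are rigorous "not refuting" verdicts -/

/-- **A certified feasible rule makes a zoo non-refuting.**  If some rule `Φ` has all its site energies on the
zoo `Z` at radius `R` at least `−0.7175`, then `Z` is not in the hypothesis shape of `not_rungAt_of_zoo` at `R`
(no statement about the rung itself: the LP is a refuter, never a prover). -/
theorem not_refuting_of_certificate (R : ℝ) (Z : Finset (Σ N : ℕ, Fin N → EuclideanSpace ℝ (Fin 3)))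
    {Φ : EuclideanSpace ℝ (Fin 3) → Finset (EuclideanSpace ℝ (Fin 3)) → ℝ} (hΦ : IsRule Φ)
    (hcert : ∀ c ∈ Z, ∀ i : Fin c.1, -(7175 / 10000 : ℝ) ≤ siteE R Φ c.2 i) :
    ¬ ∀ Ψ : EuclideanSpace ℝ (Fin 3) → Finset (EuclideanSpace ℝ (Fin 3)) → ℝ, IsRule Ψ →
        ∃ c ∈ Z, ∃ i : Fin c.1, siteE R Ψ c.2 i < eInf := by
  intro href
  obtain ⟨c, hc, i, hlt⟩ := href Φ hΦ
  exact (not_lt.2 (eInf_le_ref.trans (hcert c hc i))) hlt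

/-- The same with the sharper symbolic threshold `e*_hcp` (for certificates checked against a finer enclosure). -/
theorem not_refuting_of_certificate' (R : ℝ) (Z : Finset (Σ N : ℕ, Fin N → EuclideanSpace ℝ (Fin 3)))
    {Φ : EuclideanSpace ℝ (Fin 3) → Finset (EuclideanSpace ℝ (Fin 3)) → ℝ} (hΦ : IsRule Φ)
    (hcert : ∀ c ∈ Z, ∀ i : Fin c.1,
      -(hcpInvPowSum 3 (Real.sqrt (2 / 3)) ^ 2 / (24 * hcpInvPowSum 6 (Real.sqrt (2 / 3)))) ≤
        siteE R Φ c.2 i) :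
    ¬ ∀ Ψ : EuclideanSpace ℝ (Fin 3) → Finset (EuclideanSpace ℝ (Fin 3)) → ℝ, IsRule Ψ →
        ∃ c ∈ Z, ∃ i : Fin c.1, siteE R Ψ c.2 i < eInf := by
  intro href
  obtain ⟨c, hc, i, hlt⟩ := href Φ hΦ
  exact (not_lt.2 (eInf_le_hcpOptimalEnergy.trans (hcert c hc i))) hlt

/-! ## hcp zoos, by name -/

/-- **A zoo of ideal-hcp fragments is never refuting.**  If every configuration of `Z` is an injective fragment
of some ideal hcp stacking `hcpStacking a (a * √(2/3))` with `a > 0`, `a⁶ ≥ 1/2` (the spacings may differ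
between configurations), then at every radius `R` the half rule is feasible on all of `Z`, so `Z` is not in the
hypothesis shape of `not_rungAt_of_zoo`. -/
theorem not_refuting_of_hcp_fragments (R : ℝ) (Z : Finset (Σ N : ℕ, Fin N → EuclideanSpace ℝ (Fin 3)))
    (hZ : ∀ c ∈ Z, Function.Injective c.2 ∧
      ∃ a : ℝ, 0 < a ∧ 1 / 2 ≤ a ^ 6 ∧ ∀ i, c.2 i ∈ hcpStacking a (a * Real.sqrt (2 / 3))) :
    ¬ ∀ Ψ : EuclideanSpace ℝ (Fin 3) → Finset (EuclideanSpace ℝ (Fin 3)) → ℝ, IsRule Ψ →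
        ∃ c ∈ Z, ∃ i : Fin c.1, siteE R Ψ c.2 i < eInf := by
  intro href
  obtain ⟨c, hc, i, hlt⟩ := href halfRule isRule_halfRule
  obtain ⟨hx, a, ha, h6, hxP⟩ := hZ c hc
  have hid : (a * Real.sqrt (2 / 3)) ^ 2 = 2 * a ^ 2 / 3 := by
    rw [mul_pow, Real.sq_sqrt (by norm_num : (0 : ℝ) ≤ 2 / 3)]
    ring
  exact (not_lt.2 (halfRule_feasibleOn_hcp_ideal ha hid h6 R hx hxP i)) hlt

end Summit.AtomisticToContinuum.Crystallization.Theorems.StrictSplittingRuleBirth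

end
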